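import Summits.PneNP.PneNP.Theorems.ChebyshevTracialDesignGammaDirectionTools
import HarnessLib

/-!
# Cell pnp-psdrank, route `ChebyshevTracialDesign`: the two VIRTUALLY NULL `n_A`-terms of the γ-direction (crux `TracialDecayExp20`,
# stmt-PneNP-19878)

Brick 129b (prover g26; MEMO-28 §3c line (L-b), MEMO-29). With `X = |U∩H|`, `Y = |half_M U ∩ H|`, `n_A(U)` the number of `HH` edges of `M`
inside `U`, `c = cc(U,M)`, the tilted mask of the γ-direction is `ψ(X)·(2γ n_A + 2λ(X−Y) + κ(t−c))²` and expands (brick 129) into brick 120's seven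
crossing-plane terms plus THREE terms carrying `n_A`; the two treated here carry a factor `c` in their level profile and are therefore
VIRTUALLY NULL (brick 119 §1: the Newton extrapolation of `c·θ(c)` to the virtual level `c = 0` is a single top-order difference):
(T8) the level-weighted term `cc·ψ(X)·n_A`: by full-edge pinning (brick 129a §3) `E_c[ψ n_A] = ((t−c)/n)·Σ_v E′_v(c)`, so `E_c[cc·ψ·n_A] = c·(t−c)θ₁(c)`:
**`abs_designValue_level_hhCount_blockStat_le`**;
(T9) the mixed term `ψ(X)·n_A·Y`: by one full and one half pin (Literature `ShellLawMixedPinning`) `E_c = (c(t−c)/(n(n−2)))·Σ_vΣ_w E‴_{vw}(c−1)`: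
**`abs_designValue_hhCount_halfCount_blockStat_le`**.
Both are PURE REMAINDERS of orders `D−1, D, D+1` in the `x`-smoothness numbers `X_k` of deleted shell laws (one hypothesis family per pinning pattern:
ground sets `[n]` minus the pinned edges and `2k` deleted edges, cut `t−2−2k` resp. `t−3−2k`), via the affine Leibniz rule (129a §1) for the factor `t−c`;
the combinatorial prefactors `|reps vAA|/n`, `|reps vAA|·(n−2)/(n(n−2))` are majorised by `1`. Levels up to `T` are used two cut sizes down, whence the
hypothesis `T + 4 ≤ t` (harmless: `T = 4⌊√n⌋+3`, `t ≥ n/4`). The third `n_A`-term (the `n_A`-part of the main profile) is brick 129c.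
WHAT THIS FILE DOES NOT DO: the assembly with brick 120 (brick 129), bound the `X_k` (bricks 118/125-type discharge), sign the main term ((O3)),
anything on `TracialDecayExp20` itself, psd rank of P_PM(K_n), or P vs NP.
[cite: Rothvoss2017, §2 (PDF p. 6)] [cite: Agarwal2000DifferenceEquations, Thm. 1.8.5 (1.8.6), Remark 1.8.1 (1.8.8)]
[cite: Boole2009, Ch. II Art. 10 Ex. 3 eq. (8) (PDF pp. 34–35)] [cite: GriblingDelaatLaurent2019, §5]
Stature: support/instrument (kernel lane, no defs, axioms standard). Supports stmt-PneNP-19878.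
-/

set_option linter.dupNamespace false -- `Summit.PneNP.PneNP.…`: summit = sub-problem (D-0017)

noncomputable section

namespace Summit.PneNP.PneNP.Theorems.ChebyshevTracialDesignGammaDirectionNullTerms

open Finset Polynomial Literature.Barriers.PneNP Literature.Combinatorics.Optimization
open Literature.Combinatorics.Optimization.ShellStep
open Summit.PneNP.PneNP.Theorems.ChebyshevTracialDesignShellOperatorForm (designValue_eq_shellAvg shell_partner_nonempty)
open Summit.PneNP.PneNP.Theorems.ChebyshevTracialDesignBlockStatisticPricing (fwdDiff_iter_one_odd pairs_hyp rho_nonneg)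
open Summit.PneNP.PneNP.Theorems.ChebyshevTracialDesignHalfPinnedNull (abs_levelSum_levelMul_le fwdDiff_iter_one_even
  fwdDiff_iter_mul_sum)
open Summit.PneNP.PneNP.Theorems.ChebyshevTracialDesignCrossingPlaneTools (designValue_ccPow_eq_shellAvg)
open Summit.PneNP.PneNP.Theorems.ChebyshevTracialDesignGammaDirectionTools

variable {n : ℕ}
/-! ### (T8) The level-weighted term `cc · ψ(X) · n_A` is virtually null -/

/-- **(T8) `cc·ψ(|U∩H|)·n_A(U)` is a pure remainder.** For an exact design `(n,t,T,D,B_v,C,w)` with `T + 4 ≤ t`, a perfect matching `M` (partner map `π`),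
a block `H`, `|ψ| ≤ G` on `[0,t]`, `m ≥ 3`, `m + 4(D+1) + 4 ≤ n`, `2D+1 ≤ T`, and `x`-smoothness numbers `X_k ≥ 0` (`k ∈ {D−1, D, D+1}`, odd base levels `c′`,
`c′ + 2k ≤ T`, every `π`-stable `S′` with `|S′| + 4k + 2 = n`, cut `t − 2 − 2k`, window `[0, t−2]`):
`| |PM|·Σ_U W(U,M)·cc(U,M)·ψ(|U∩H|)·n_A(U) | ≤ (2D+1)(C(2D,D)/4^D)·K_D + B_v·C((T−1)/2,D+1)·(T·K_{D+1} + 2(D+1)·K_D)`,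
`K_k = t·Gρ^kX_k + 2k·Gρ^{k−1}X_{k−1}` (`E_c[ψ n_A] = ((t−c)/n)·Σ_v E′_v(c)`, factor `c(t−c)`: brick 119 §1 with the affine Leibniz rule).
[cite: Rothvoss2017, §2 (PDF p. 6)] [cite: Agarwal2000DifferenceEquations, Thm. 1.8.5 (1.8.6), Remark 1.8.1 (1.8.8)]
[cite: Boole2009, Ch. II Art. 10 Ex. 3 eq. (8) (PDF pp. 34–35)] -/
theorem abs_designValue_level_hhCount_blockStat_le {t T D : ℕ} {Bv : ℝ} {C : Finset ℕ} {w : ℕ → ℝ}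
    (hdes : IsExactDesign n t T D Bv C w) (hDT : 2 * D + 1 ≤ T) (hT4 : T + 4 ≤ t) (M : PMatch n)
    (H : Finset (Fin n)) (ψ : ℤ → ℝ) {G : ℝ} (hG0 : 0 ≤ G) (hG : ∀ x ∈ Icc (0 : ℤ) (t : ℤ), |ψ x| ≤ G)
    {m : ℕ} (hm : 3 ≤ m) (hmn : m + 4 * (D + 1) + 4 ≤ n) (X : ℕ → ℝ) (hX0 : ∀ k, 0 ≤ X k)
    (hX : ∀ k, D ≤ k + 1 → k ≤ D + 1 → ∀ c' : ℕ, Odd c' → c' + 2 * k ≤ T →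
      ∀ S' : Finset (Fin n), (∀ u ∈ S', M.2.partner u ∈ S') → S'.card + 4 * k + 2 = n →
      ∑ x ∈ Icc (0 : ℤ) ((t - 2 : ℕ) : ℤ),
        |nab2^[k] (fun c x => shellLaw M.2.partner S' H (t - 2 - 2 * k) c x : Profile) c' x| ≤ X k) :
    |(Fintype.card (PMatch n) : ℝ) * ∑ U : OddSet n, levelWeight n t C w U M *
        ((cc U M : ℝ) ^ 1 * (ψ ((U.1 ∩ H).card : ℤ) *
          ((((reps M.2.partner (vAA M.2.partner univ H)).filter fun v => v ∈ U.1 ∧ M.2.partner v ∈ U.1).card : ℕ) : ℝ)))| ≤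
      (2 * (D : ℝ) + 1) * ((((2 * D).choose D : ℕ) : ℝ) / (4 : ℝ) ^ D) *
          ((t : ℝ) * (G * (((m : ℝ) / (4 * ((m : ℝ) - 2))) ^ D * X D)) +
            2 * (D : ℝ) * (G * (((m : ℝ) / (4 * ((m : ℝ) - 2))) ^ (D - 1) * X (D - 1)))) +
        Bv * ((((T - 1) / 2).choose (D + 1) : ℕ) : ℝ) *
          ((T : ℝ) * ((t : ℝ) * (G * (((m : ℝ) / (4 * ((m : ℝ) - 2))) ^ (D + 1) * X (D + 1))) +
              2 * ((D : ℝ) + 1) * (G * (((m : ℝ) / (4 * ((m : ℝ) - 2))) ^ D * X D))) +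
            2 * ((D : ℝ) + 1) * ((t : ℝ) * (G * (((m : ℝ) / (4 * ((m : ℝ) - 2))) ^ D * X D)) +
              2 * (D : ℝ) * (G * (((m : ℝ) / (4 * ((m : ℝ) - 2))) ^ (D - 1) * X (D - 1))))) := by
  obtain ⟨t₀, rfl⟩ : ∃ t₀, t = t₀ + 2 := ⟨t - 2, by omega⟩
  simp only [Nat.add_sub_cancel] at hX
  set π := M.2.partner with hπdef
  have hπ : ∀ v, π (π v) = v := partner_partner M
  have hπ' : ∀ v, π v ≠ v := partner_ne M
  set ρ : ℝ := (m : ℝ) / (4 * ((m : ℝ) - 2)) with hρdef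
  have hρ0 : 0 ≤ ρ := rho_nonneg hm
  have ht : Odd (t₀ + 2) := hdes.1
  have ht₀ : Odd t₀ := by obtain ⟨i, hi⟩ := ht; exact ⟨i - 1, by omega⟩
  have h2t : 2 * (t₀ + 2) + 2 ≤ n := hdes.2.1
  have hPM : (0 : ℝ) < (Fintype.card (PMatch n) : ℝ) := by
    have : 0 < Fintype.card (PMatch n) := Fintype.card_pos_iff.2 ⟨M⟩
    exact_mod_cast this
  have hn0 : (0 : ℝ) < n := by
    have : 0 < n := by omega
    exact_mod_cast this
  set R := reps π (vAA π univ H) with hRdef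
  have hRn : (R.card : ℝ) ≤ n := by
    have := card_le_univ R
    rw [Fintype.card_fin] at this
    exact_mod_cast this
  -- the deleted shifted profiles, their odd subsequence `g`, and `θ`
  set φ' : Fin n → ℕ → ℝ := fun v c => (∑ W ∈ shellIn π (univ \ {v, π v}) t₀ c, ψ (((W ∩ H).card : ℤ) + 2)) /
    ((shellIn π (univ \ {v, π v}) t₀ c).card : ℝ) with hφ'
  set g : ℕ → ℝ := fun y => (1 / (n : ℝ)) * ∑ v ∈ R, φ' v (2 * y + 1) with hg
  set θ : ℕ → ℝ := fun c => ((t₀ : ℝ) + 2 - c) * ((1 / (n : ℝ)) * ∑ v ∈ R, φ' v c) with hθ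
  -- Step 1: `|PM|·Σ_U W·cc·g = Σ_c w_c (c·θ(c))`
  have hval : (Fintype.card (PMatch n) : ℝ) * ∑ U : OddSet n, levelWeight n (t₀ + 2) C w U M *
      ((cc U M : ℝ) ^ 1 * (ψ ((U.1 ∩ H).card : ℤ) *
        ((((reps π (vAA π univ H)).filter fun v => v ∈ U.1 ∧ π v ∈ U.1).card : ℕ) : ℝ))) =
      ∑ c ∈ C, w c * ((c : ℝ) * θ c) := by
    rw [designValue_ccPow_eq_shellAvg (t₀ + 2) ht C w M (fun U₁ => ψ ((U₁ ∩ H).card : ℤ) *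
        ((((reps π (vAA π univ H)).filter fun v => v ∈ U₁ ∧ π v ∈ U₁).card : ℕ) : ℝ)) 1,
      ← mul_assoc, mul_inv_cancel₀ hPM.ne', one_mul]
    refine sum_congr rfl fun c hc => ?_
    obtain ⟨hcodd, h3c, hcT, -⟩ := hdes.2.2.2.1 c hc
    rw [pow_one, shellAvg_hhCount_eq M H ψ ht hcodd (by omega) (by omega)]
    simp only [hθ, hφ', hRdef]
    ring
  rw [hval]
  -- Step 2: smoothness of `g`
  have hG' : ∀ x ∈ Icc (0 : ℤ) ((t₀ : ℕ) : ℤ), |ψ (x + 2)| ≤ G := by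
    intro x hx
    refine hG (x + 2) ?_
    rw [mem_Icc] at hx ⊢
    constructor
    · linarith [hx.1]
    · have := hx.2; push_cast at this ⊢; linarith
  have hKg : ∀ k, D ≤ k + 1 → k ≤ D + 1 → ∀ y : ℕ, 2 * (y + k) + 1 ≤ T →
      |((fwdDiff (1 : ℕ))^[k] g) y| ≤ G * (ρ ^ k * X k) := by
    intro k hDk hkD y hy
    have hfun : g = fun y => (1 / (n : ℝ)) * ∑ v ∈ R, (fun v y => φ' v (2 * y + 1)) v y := by
      funext y; rw [hg]
    rw [hfun, fwdDiff_iter_mul_sum, abs_mul, abs_of_nonneg (by positivity : (0 : ℝ) ≤ 1 / (n : ℝ))]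
    have hsplit : t₀ = (t₀ - 2 * k) + 2 * k := by omega
    have hbd : ∀ v ∈ R, |(fwdDiff (1 : ℕ))^[k] (fun y => φ' v (2 * y + 1)) y| ≤ G * (ρ ^ k * X k) := by
      intro v _
      rw [fwdDiff_iter_one_odd, hφ']
      simp only
      rw [hsplit]
      refine abs_fwdDiff_iter_pin1Profile_le M v H (fun x => ψ (x + 2)) hG0 (by rw [← hsplit]; exact hG')
        (by rw [← hsplit]; exact ht₀) ⟨y, by ring⟩ (by omega) (by omega) hm (by omega) (hX0 k) ?_
      intro S' hS' hcard
      have := hX k hDk hkD (2 * y + 1) ⟨y, by ring⟩ (by omega) S' hS' hcard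
      rw [← hsplit]
      convert this using 4
    have hsum : |∑ v ∈ R, (fwdDiff (1 : ℕ))^[k] (fun y => φ' v (2 * y + 1)) y| ≤ (R.card : ℝ) * (G * (ρ ^ k * X k)) :=
      calc |∑ v ∈ R, (fwdDiff (1 : ℕ))^[k] (fun y => φ' v (2 * y + 1)) y|
          ≤ ∑ v ∈ R, |(fwdDiff (1 : ℕ))^[k] (fun y => φ' v (2 * y + 1)) y| := abs_sum_le_sum_abs _ _
        _ ≤ ∑ v ∈ R, G * (ρ ^ k * X k) := sum_le_sum hbd
        _ = (R.card : ℝ) * (G * (ρ ^ k * X k)) := by rw [sum_const, nsmul_eq_mul]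
    have hGX : 0 ≤ G * (ρ ^ k * X k) := mul_nonneg hG0 (mul_nonneg (pow_nonneg hρ0 k) (hX0 k))
    calc 1 / (n : ℝ) * |∑ v ∈ R, (fwdDiff (1 : ℕ))^[k] (fun y => φ' v (2 * y + 1)) y|
        ≤ 1 / (n : ℝ) * ((n : ℝ) * (G * (ρ ^ k * X k))) :=
          mul_le_mul_of_nonneg_left (hsum.trans (mul_le_mul_of_nonneg_right hRn hGX)) (by positivity)
      _ = G * (ρ ^ k * X k) := by field_simp
  -- Step 3: the odd subsequence of `θ` is `(t₀ + 1 − 2y)·g(y)`; affine Leibniz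
  have hθodd : (fun y : ℕ => θ (2 * y + 1)) = fun y : ℕ => (((t₀ : ℝ) + 1) - 2 * (y : ℝ)) * g y := by
    funext y
    simp only [hθ, hg]
    push_cast
    ring
  have hK : ∀ k, D ≤ k → k ≤ D + 1 → ∀ y : ℕ, 2 * (y + k) + 1 ≤ T →
      |((fwdDiff (1 : ℕ))^[k] (fun y => θ (2 * y + 1))) y| ≤
        ((t₀ : ℝ) + 2) * (G * (ρ ^ k * X k)) + 2 * (k : ℝ) * (G * (ρ ^ (k - 1) * X (k - 1))) := by
    intro k hDk hkD y hy
    rw [hθodd]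
    have hyT : 2 * (y : ℝ) ≤ (t₀ : ℝ) + 1 := by exact_mod_cast (show 2 * y ≤ t₀ + 1 by omega)
    have hy0 : (0 : ℝ) ≤ y := Nat.cast_nonneg _
    have hA : |((t₀ : ℝ) + 1) - 2 * (y : ℝ)| ≤ (t₀ : ℝ) + 2 := by
      rw [abs_le]; constructor <;> linarith
    refine (abs_fwdDiff_iter_affMul_le g k y hA).trans ?_
    have h1 := hKg k (by omega) hkD y hy
    have h2 : 2 * (k : ℝ) * |(fwdDiff (1 : ℕ))^[k - 1] g (y + 1)| ≤ 2 * (k : ℝ) * (G * (ρ ^ (k - 1) * X (k - 1))) := by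
      rcases Nat.eq_zero_or_pos k with hk0 | hkpos
      · subst hk0; simp
      · exact mul_le_mul_of_nonneg_left (hKg (k - 1) (by omega) (by omega) (y + 1) (by omega)) (by positivity)
    exact add_le_add (mul_le_mul_of_nonneg_left h1 (by positivity)) h2
  -- Step 4: brick 119 §1
  have hK0 : ∀ k, 0 ≤ ((t₀ : ℝ) + 2) * (G * (ρ ^ k * X k)) + 2 * (k : ℝ) * (G * (ρ ^ (k - 1) * X (k - 1))) :=
    fun k => add_nonneg (mul_nonneg (by positivity) (mul_nonneg hG0 (mul_nonneg (pow_nonneg hρ0 _) (hX0 _))))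
      (mul_nonneg (by positivity) (mul_nonneg hG0 (mul_nonneg (pow_nonneg hρ0 _) (hX0 _))))
  have hfin := abs_levelSum_levelMul_le hdes.exact hdes.variation_le hdes.level_le (fun c hc => (hdes.2.2.2.1 c hc).1) hDT θ
    (hK0 D) (hK0 (D + 1)) (fun j hj => hK D le_rfl (by omega) j hj) (fun j hj => hK (D + 1) (by omega) le_rfl j hj)
  refine hfin.trans (le_of_eq ?_)
  simp only [Nat.add_sub_cancel]
  push_cast
  ring

/-! ### (T9) The mixed term `ψ(X) · n_A · Y` is virtually null -/

/-- **(T9) `ψ(|U∩H|)·n_A(U)·|half_M U ∩ H|` is a pure remainder.** For an exact design `(n,t,T,D,B_v,C,w)` with `T + 4 ≤ t`, a perfect matching `M`,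
a block `H`, `|ψ| ≤ G` on `[0,t]`, `m ≥ 3`, `m + 4(D+1) + 4 ≤ n`, `2D+1 ≤ T`, and `x`-smoothness numbers `X_k ≥ 0` (`k ∈ {D−1, D, D+1}`, EVEN base levels `c′`,
`c′ + 2k + 1 ≤ T`, every `π`-stable `S′` with `|S′| + 4k + 4 = n`, cut `t − 3 − 2k`, window `[0, t−3]`):
`| |PM|·Σ_U W(U,M)·ψ(|U∩H|)·n_A(U)·|half_M U ∩ H| | ≤ (2D+1)(C(2D,D)/4^D)·K_D + B_v·C((T−1)/2,D+1)·(T·K_{D+1} + 2(D+1)·K_D)`,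
`K_k = t·Gρ^kX_k + 2k·Gρ^{k−1}X_{k−1}` (one full and one half pin: `E_c = (c(t−c)/(n(n−2)))·Σ_vΣ_w E‴_{vw}(c−1)`, factor `c`).
[cite: Rothvoss2017, §2 (PDF p. 6)] [cite: Agarwal2000DifferenceEquations, Thm. 1.8.5 (1.8.6), Remark 1.8.1 (1.8.8)]
[cite: Boole2009, Ch. II Art. 10 Ex. 3 eq. (8) (PDF pp. 34–35)] -/
theorem abs_designValue_hhCount_halfCount_blockStat_le {t T D : ℕ} {Bv : ℝ} {C : Finset ℕ} {w : ℕ → ℝ}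
    (hdes : IsExactDesign n t T D Bv C w) (hDT : 2 * D + 1 ≤ T) (hT4 : T + 4 ≤ t) (M : PMatch n)
    (H : Finset (Fin n)) (ψ : ℤ → ℝ) {G : ℝ} (hG0 : 0 ≤ G) (hG : ∀ x ∈ Icc (0 : ℤ) (t : ℤ), |ψ x| ≤ G)
    {m : ℕ} (hm : 3 ≤ m) (hmn : m + 4 * (D + 1) + 4 ≤ n) (X : ℕ → ℝ) (hX0 : ∀ k, 0 ≤ X k)
    (hX : ∀ k, D ≤ k + 1 → k ≤ D + 1 → ∀ c' : ℕ, Even c' → c' + 2 * k + 1 ≤ T →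
      ∀ S' : Finset (Fin n), (∀ u ∈ S', M.2.partner u ∈ S') → S'.card + 4 * k + 4 = n →
      ∑ x ∈ Icc (0 : ℤ) ((t - 3 : ℕ) : ℤ),
        |nab2^[k] (fun c x => shellLaw M.2.partner S' H (t - 3 - 2 * k) c x : Profile) c' x| ≤ X k) :
    |(Fintype.card (PMatch n) : ℝ) * ∑ U : OddSet n, levelWeight n t C w U M *
        (ψ ((U.1 ∩ H).card : ℤ) *
          ((((reps M.2.partner (vAA M.2.partner univ H)).filter fun v => v ∈ U.1 ∧ M.2.partner v ∈ U.1).card : ℕ) : ℝ) *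
          ((half M.2.partner U.1 ∩ H).card : ℝ))| ≤
      (2 * (D : ℝ) + 1) * ((((2 * D).choose D : ℕ) : ℝ) / (4 : ℝ) ^ D) *
          ((t : ℝ) * (G * (((m : ℝ) / (4 * ((m : ℝ) - 2))) ^ D * X D)) +
            2 * (D : ℝ) * (G * (((m : ℝ) / (4 * ((m : ℝ) - 2))) ^ (D - 1) * X (D - 1)))) +
        Bv * ((((T - 1) / 2).choose (D + 1) : ℕ) : ℝ) *
          ((T : ℝ) * ((t : ℝ) * (G * (((m : ℝ) / (4 * ((m : ℝ) - 2))) ^ (D + 1) * X (D + 1))) +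
              2 * ((D : ℝ) + 1) * (G * (((m : ℝ) / (4 * ((m : ℝ) - 2))) ^ D * X D))) +
            2 * ((D : ℝ) + 1) * ((t : ℝ) * (G * (((m : ℝ) / (4 * ((m : ℝ) - 2))) ^ D * X D)) +
              2 * (D : ℝ) * (G * (((m : ℝ) / (4 * ((m : ℝ) - 2))) ^ (D - 1) * X (D - 1))))) := by
  obtain ⟨t₀, rfl⟩ : ∃ t₀, t = t₀ + 3 := ⟨t - 3, by omega⟩
  simp only [Nat.add_sub_cancel] at hX
  set π := M.2.partner with hπdef
  have hπ : ∀ v, π (π v) = v := partner_partner M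
  have hπ' : ∀ v, π v ≠ v := partner_ne M
  have hU : ∀ u ∈ (univ : Finset (Fin n)), π u ∈ (univ : Finset (Fin n)) := fun u _ => mem_univ _
  set ρ : ℝ := (m : ℝ) / (4 * ((m : ℝ) - 2)) with hρdef
  have hρ0 : 0 ≤ ρ := rho_nonneg hm
  have ht : Odd (t₀ + 3) := hdes.1
  have h2t : 2 * (t₀ + 3) + 2 ≤ n := hdes.2.1
  have hPM : (0 : ℝ) < (Fintype.card (PMatch n) : ℝ) := by
    have : 0 < Fintype.card (PMatch n) := Fintype.card_pos_iff.2 ⟨M⟩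
    exact_mod_cast this
  have hn4 : (4 : ℝ) ≤ n := by exact_mod_cast (show 4 ≤ n by omega)
  set κ₀ : ℝ := 1 / ((n : ℝ) * ((n : ℝ) - 2)) with hκ₀def
  have hκ₀0 : 0 ≤ κ₀ := by rw [hκ₀def]; exact div_nonneg zero_le_one (mul_nonneg (by linarith) (by linarith))
  set R := reps π (vAA π univ H) with hRdef
  have hRn : (R.card : ℝ) ≤ n := by
    have := card_le_univ R
    rw [Fintype.card_fin] at this
    exact_mod_cast this
  have hHv : ∀ v : Fin n, (((univ \ {v, π v}) ∩ H).card : ℝ) ≤ (n : ℝ) - 2 := by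
    intro v
    have h1 := card_sdiff_pair hπ' hU (mem_univ v)
    rw [card_univ, Fintype.card_fin] at h1
    have h2 : ((univ \ {v, π v}) ∩ H).card ≤ (univ \ {v, π v} : Finset (Fin n)).card := card_le_card inter_subset_left
    have h3 : ((((univ \ {v, π v}) ∩ H).card : ℕ) : ℝ) + 2 ≤ n := by exact_mod_cast (by omega)
    linarith
  -- the doubly deleted shifted profiles, `Gs`, its even subsequence `g`, and `θ`
  set φ'' : Fin n → Fin n → ℕ → ℝ := fun v w c =>
    (∑ W ∈ shellIn π ((univ \ {v, π v}) \ {w, π w}) t₀ c, ψ (((W ∩ H).card : ℤ) + 3)) /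
      ((shellIn π ((univ \ {v, π v}) \ {w, π w}) t₀ c).card : ℝ) with hφ''
  set Gs : ℕ → ℝ := fun c => κ₀ * ∑ v ∈ R, ∑ w ∈ (univ \ {v, π v}) ∩ H, φ'' v w c with hGs
  set g : ℕ → ℝ := fun y => Gs (2 * y) with hg
  set θ : ℕ → ℝ := fun c => ((t₀ : ℝ) + 3 - c) * Gs (c - 1) with hθ
  -- Step 1: `|PM|·Σ_U W·g = Σ_c w_c (c·θ(c))`
  have hval : (Fintype.card (PMatch n) : ℝ) * ∑ U : OddSet n, levelWeight n (t₀ + 3) C w U M *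
      (ψ ((U.1 ∩ H).card : ℤ) *
        ((((reps π (vAA π univ H)).filter fun v => v ∈ U.1 ∧ π v ∈ U.1).card : ℕ) : ℝ) *
        ((half π U.1 ∩ H).card : ℝ)) = ∑ c ∈ C, w c * ((c : ℝ) * θ c) := by
    rw [designValue_eq_shellAvg (t₀ + 3) ht C w M (fun U₁ => ψ ((U₁ ∩ H).card : ℤ) *
        ((((reps π (vAA π univ H)).filter fun v => v ∈ U₁ ∧ π v ∈ U₁).card : ℕ) : ℝ) * ((half π U₁ ∩ H).card : ℝ)),
      ← mul_assoc, mul_inv_cancel₀ hPM.ne', one_mul]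
    refine sum_congr rfl fun c hc => ?_
    obtain ⟨hcodd, h3c, hcT, -⟩ := hdes.2.2.2.1 c hc
    obtain ⟨c₀, rfl⟩ : ∃ c₀, c = c₀ + 1 := ⟨c - 1, by omega⟩
    congr 1
    rw [shellAvg_hhCount_halfCount_eq M H ψ ht hcodd (by omega) (by omega)]
    simp only [hθ, hGs, hφ'', hRdef, hκ₀def, Nat.add_sub_cancel]
    push_cast
    ring
  rw [hval]
  -- Step 2: smoothness of `g` (even levels of the doubly deleted ground sets)
  have hG' : ∀ x ∈ Icc (0 : ℤ) ((t₀ : ℕ) : ℤ), |ψ (x + 3)| ≤ G := by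
    intro x hx
    refine hG (x + 3) ?_
    rw [mem_Icc] at hx ⊢
    constructor
    · linarith [hx.1]
    · have := hx.2; push_cast at this ⊢; linarith
  have hKg : ∀ k, D ≤ k + 1 → k ≤ D + 1 → ∀ y : ℕ, 2 * (y + k) + 1 ≤ T →
      |((fwdDiff (1 : ℕ))^[k] g) y| ≤ G * (ρ ^ k * X k) := by
    intro k hDk hkD y hy
    have hGX : 0 ≤ G * (ρ ^ k * X k) := mul_nonneg hG0 (mul_nonneg (pow_nonneg hρ0 k) (hX0 k))
    have hfun : g = fun y => κ₀ * ∑ v ∈ R, (fun v y => ∑ w ∈ (univ \ {v, π v}) ∩ H, φ'' v w (2 * y)) v y := by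
      funext y; rw [hg, hGs]
    rw [hfun, fwdDiff_iter_mul_sum, abs_mul, abs_of_nonneg hκ₀0]
    have hsplit : t₀ = (t₀ - 2 * k) + 2 * k := by omega
    have hinner : ∀ v ∈ R, |(fwdDiff (1 : ℕ))^[k] (fun y => ∑ w ∈ (univ \ {v, π v}) ∩ H, φ'' v w (2 * y)) y| ≤
        ((n : ℝ) - 2) * (G * (ρ ^ k * X k)) := by
      intro v _
      have hfun2 : (fun y => ∑ w ∈ (univ \ {v, π v}) ∩ H, φ'' v w (2 * y)) =
          fun y => (1 : ℝ) * ∑ w ∈ (univ \ {v, π v}) ∩ H, (fun w y => φ'' v w (2 * y)) w y := by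
        funext y; rw [one_mul]
      rw [hfun2, fwdDiff_iter_mul_sum, one_mul]
      have hbd : ∀ w' ∈ (univ \ {v, π v}) ∩ H, |(fwdDiff (1 : ℕ))^[k] (fun y => φ'' v w' (2 * y)) y| ≤ G * (ρ ^ k * X k) := by
        intro w' hw'
        have hw'1 : w' ∈ (univ : Finset (Fin n)) \ {v, π v} := (mem_inter.1 hw').1
        rw [fwdDiff_iter_one_even, hφ'']
        simp only
        rw [hsplit]
        refine abs_fwdDiff_iter_pin11Profile_le M hw'1 H (fun x => ψ (x + 3)) hG0 (by rw [← hsplit]; exact hG')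
          (by rw [← hsplit]; exact ht) ⟨y, by ring⟩ (by omega) (by omega) hm (by omega) (hX0 k) ?_
        intro S' hS' hcard
        have := hX k hDk hkD (2 * y) ⟨y, by ring⟩ (by omega) S' hS' hcard
        rw [← hsplit]
        convert this using 4
      calc |∑ w' ∈ (univ \ {v, π v}) ∩ H, (fwdDiff (1 : ℕ))^[k] (fun y => φ'' v w' (2 * y)) y|
          ≤ ∑ w' ∈ (univ \ {v, π v}) ∩ H, |(fwdDiff (1 : ℕ))^[k] (fun y => φ'' v w' (2 * y)) y| := abs_sum_le_sum_abs _ _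
        _ ≤ ∑ w' ∈ (univ \ {v, π v}) ∩ H, G * (ρ ^ k * X k) := sum_le_sum hbd
        _ = (((univ \ {v, π v}) ∩ H).card : ℝ) * (G * (ρ ^ k * X k)) := by rw [sum_const, nsmul_eq_mul]
        _ ≤ ((n : ℝ) - 2) * (G * (ρ ^ k * X k)) := mul_le_mul_of_nonneg_right (hHv v) hGX
    have hsum : |∑ v ∈ R, (fwdDiff (1 : ℕ))^[k] (fun y => ∑ w ∈ (univ \ {v, π v}) ∩ H, φ'' v w (2 * y)) y| ≤
        (n : ℝ) * (((n : ℝ) - 2) * (G * (ρ ^ k * X k))) :=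
      calc |∑ v ∈ R, (fwdDiff (1 : ℕ))^[k] (fun y => ∑ w ∈ (univ \ {v, π v}) ∩ H, φ'' v w (2 * y)) y|
          ≤ ∑ v ∈ R, |(fwdDiff (1 : ℕ))^[k] (fun y => ∑ w ∈ (univ \ {v, π v}) ∩ H, φ'' v w (2 * y)) y| :=
            abs_sum_le_sum_abs _ _
        _ ≤ ∑ v ∈ R, ((n : ℝ) - 2) * (G * (ρ ^ k * X k)) := sum_le_sum hinner
        _ = (R.card : ℝ) * (((n : ℝ) - 2) * (G * (ρ ^ k * X k))) := by rw [sum_const, nsmul_eq_mul]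
        _ ≤ (n : ℝ) * (((n : ℝ) - 2) * (G * (ρ ^ k * X k))) :=
            mul_le_mul_of_nonneg_right hRn (mul_nonneg (by linarith) hGX)
    calc κ₀ * |∑ v ∈ R, (fwdDiff (1 : ℕ))^[k] (fun y => ∑ w ∈ (univ \ {v, π v}) ∩ H, φ'' v w (2 * y)) y|
        ≤ κ₀ * ((n : ℝ) * (((n : ℝ) - 2) * (G * (ρ ^ k * X k)))) := mul_le_mul_of_nonneg_left hsum hκ₀0
      _ = G * (ρ ^ k * X k) := by
          rw [hκ₀def]
          have h1 : (n : ℝ) ≠ 0 := by positivity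
          have h2 : (n : ℝ) - 2 ≠ 0 := (show (0 : ℝ) < (n : ℝ) - 2 by linarith).ne'
          field_simp
  -- Step 3: the odd subsequence of `θ` is `(t₀ + 2 − 2y)·g(y)`; affine Leibniz
  have hθodd : (fun y : ℕ => θ (2 * y + 1)) = fun y : ℕ => (((t₀ : ℝ) + 2) - 2 * (y : ℝ)) * g y := by
    funext y
    simp only [hθ, hg, Nat.add_sub_cancel]
    push_cast
    ring
  have hK : ∀ k, D ≤ k → k ≤ D + 1 → ∀ y : ℕ, 2 * (y + k) + 1 ≤ T →
      |((fwdDiff (1 : ℕ))^[k] (fun y => θ (2 * y + 1))) y| ≤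
        ((t₀ : ℝ) + 3) * (G * (ρ ^ k * X k)) + 2 * (k : ℝ) * (G * (ρ ^ (k - 1) * X (k - 1))) := by
    intro k hDk hkD y hy
    rw [hθodd]
    have hyT : 2 * (y : ℝ) ≤ (t₀ : ℝ) + 2 := by exact_mod_cast (show 2 * y ≤ t₀ + 2 by omega)
    have hy0 : (0 : ℝ) ≤ y := Nat.cast_nonneg _
    have hA : |((t₀ : ℝ) + 2) - 2 * (y : ℝ)| ≤ (t₀ : ℝ) + 3 := by
      rw [abs_le]; constructor <;> linarith
    refine (abs_fwdDiff_iter_affMul_le g k y hA).trans ?_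
    have h1 := hKg k (by omega) hkD y hy
    have h2 : 2 * (k : ℝ) * |(fwdDiff (1 : ℕ))^[k - 1] g (y + 1)| ≤ 2 * (k : ℝ) * (G * (ρ ^ (k - 1) * X (k - 1))) := by
      rcases Nat.eq_zero_or_pos k with hk0 | hkpos
      · subst hk0; simp
      · exact mul_le_mul_of_nonneg_left (hKg (k - 1) (by omega) (by omega) (y + 1) (by omega)) (by positivity)
    exact add_le_add (mul_le_mul_of_nonneg_left h1 (by positivity)) h2
  -- Step 4: brick 119 §1
  have hK0 : ∀ k, 0 ≤ ((t₀ : ℝ) + 3) * (G * (ρ ^ k * X k)) + 2 * (k : ℝ) * (G * (ρ ^ (k - 1) * X (k - 1))) :=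
    fun k => add_nonneg (mul_nonneg (by positivity) (mul_nonneg hG0 (mul_nonneg (pow_nonneg hρ0 _) (hX0 _))))
      (mul_nonneg (by positivity) (mul_nonneg hG0 (mul_nonneg (pow_nonneg hρ0 _) (hX0 _))))
  have hfin := abs_levelSum_levelMul_le hdes.exact hdes.variation_le hdes.level_le (fun c hc => (hdes.2.2.2.1 c hc).1) hDT θ
    (hK0 D) (hK0 (D + 1)) (fun j hj => hK D le_rfl (by omega) j hj) (fun j hj => hK (D + 1) (by omega) le_rfl j hj)
  refine hfin.trans (le_of_eq ?_)
  simp only [Nat.add_sub_cancel]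
  push_cast
  ring

end Summit.PneNP.PneNP.Theorems.ChebyshevTracialDesignGammaDirectionNullTerms

end
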